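import Literature.AlgebraicGeometry.HodgeTheory.WeilClassesFieldTypeFourPowersEndLevel
import Literature.AlgebraicGeometry.HodgeTheory.WeilClassesFieldIsogenyTransportOfStructure
import HarnessLib

/-!
# Moonen–Zarhin's Criterion (2), TYPE 4 FOR EVERY `d` AND `m`, FOR EVERY `X` ISOGENOUS TO A POWER `A^{n+1}` OF AN
# ABELIAN VARIETY WITH CM CENTRE, from `End(A)`-level data: the dichotomy as printed («`X` isogenous to `Y^m`») and
# «decomposable ⟺ `θ = 0`» read on the power through the transported field (Moonen–Zarhin 1998 §1, Criterion (2))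

Layer `Literature/AlgebraicGeometry/HodgeTheory`; THEOREMS ONLY — no definition, no named fact, no `sorry` (D-0026, net
debt 0).  Assembly of the seat's `WeilClassesFieldTypeFourPowersEndLevel` (generation 26, g26-#2: the type-4 row on
`A^{n+1}` from `End(A)`-level data — balance form and `θ` as printed) with `WeilClassesFieldIsogenyTransportOfStructure`
(generation 18: along a bare isogeny `f : Y ⟶ X` with quasi-inverse `g`, `g ≫ f = [k]`, the field `F = ℚ(φ) ⊂ End⁰(X)`
is transported to `Y` as `ℚ(f ≫ φ ≫ g)` with the rescaled minimal polynomial `P_k = P.scaleRoots k`, and decomposability /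
exceptionality / algebraicity of `W_F` correspond).  The print's hypothesis is «`X` isogenous to a power `Y^m` of a simple
abelian variety `Y` … of Type 4»; here `X = Z` is ANY complex abelian variety isogenous to `A^{n+1}` (an isogeny
`f : A^{n+1} ⟶ Z`), `A` being any complex abelian variety whose endomorphism algebra has CM centre `E = ℚ(ψ)` in the
`End(A)`-level sense of the seat's files (simplicity of `A` is not needed; «type 4» is the hypothesis on the centre).

## The print

B. J. J. Moonen, Yu. G. Zarhin, *Weil classes on abelian varieties*, J. reine angew. Math. **496** (1998) 83–92 =
arXiv:alg-geom/9612017 [MoonenZarhin1998WeilClasses] (held text `paper:arxiv-alg-geom_9612017`), §1, VERBATIM: «Since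
everything only depends on `X` up to isogeny, we may even assume that `X = Y^m` for some `m ≥ 1`, where `Y` is simple.
Let `D = End⁰(Y)`, let `E` be the center of `D`» (chunk p0002 L44–L47); Criterion (2) (chunk p0003 L59–L80): «Suppose
`X` is isogenous to a power `Y^m` of a simple abelian variety `Y` … Suppose `F ↪ End⁰(X)` is a subfield such that
`W_F = ⋀^r_F V_X` consists of Hodge classes …  Then either all classes in `W_F` are decomposable, or all non-zero classes
in `W_F` are exceptional; this last possibility occurs precisely in the following cases: … `Y` is of Type 4, `d = 1`,
`m = 1` and `F ⊄ E₀`, `Y` is of Type 4 with `d ≥ 2` or `m ≥ 2` and the map `θ : E₋ ↪ End_F(V_X) —Tr_F→ F` is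
non-zero.»; proof (chunk p0003 L92–L106).
B. van Geemen [vanGeemen1994HodgeAV], 3.6 and proof of Lemma 5.2: «isogenies are isomorphisms on `(H₁)_ℚ` which preserve
`End_ℚ`».  D. Mumford [MumfordAV1970], §19 Remark p. 169 (quasi-inverse `g`, `g f = [deg f]`).

## Dictionary

`A` with the `End(A)`-level type-4 data of the seat's files (`0 < dim A`; `h ∈ B¹(A) ⊗ ℂ`, `h^{dim A} ≠ 0`, `Q_h`
non-degenerate; `ψ` central, `R(ψ) = 0`, `R` monic irreducible over `ℚ`; `Q_h(ψ^* x, y) = Q_h(x, ψ'^* y)`, `N'ψ' ∈ ℤ[ψ]`,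
`ψ' ≠ ψ`; every central `g₀ ∈ End(A)` with `N g₀ ∈ ℤ[ψ]`, `N ≠ 0`); the power `A^{n+1} = ⨁_{Fin (n+1)} A` with the
product polarization class `Σ πᵢ^* h`; an isogeny `f : A^{n+1} ⟶ Z` with `g : Z ⟶ A^{n+1}`, `g ≫ f = k • 𝟙`,
`f ≫ g = k • 𝟙`, `k ≠ 0`; `F = ℚ(φ) ⊆ End⁰(Z)`, `P(φ) = 0`, `P` monic irreducible of degree `e`, `e · 2m = 2 dim Z`,
`m ≠ 0`; the transported generator `f ≫ φ ≫ g ∈ End(A^{n+1})` with `P_k = P.scaleRoots k` (roots `k ρ`);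
`W_F ⊗ ℂ = weilClassesField Z φ P (2m)`, `𝒟ᵐ ⊗ ℂ = divisorClassesSpan Z.X Z.dim m`.

## What is proved

* **`weilClassesField_le_or_inf_divisorClassesSpan_eq_bot_of_isIsogeny_biproduct_of_CMCentre_End`** — THE DICHOTOMY
  AS PRINTED for every `Z` isogenous to `A^{n+1}` and every `F = ℚ(φ) ⊆ End⁰(Z)`: all classes in `W_F` decomposable,
  or all non-zero classes exceptional; packaged over `AbelianVariety.IsIsogenous` in both directions
  (`…_of_isIsogenous_biproduct_…`, `…_of_isIsogenous_biproduct'_…`).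
* **`weilClassesField_le_divisorClassesSpan_iff_forall_finrank_eq_transport_of_isIsogeny_biproduct_of_CMCentre_End`**
  («decomposable ⟺ balance», the balance computed on `A^{n+1}` for the transported generator `f ≫ φ ≫ g` at the roots
  of `P_k` against `(⊕ψ)^*`, `(⊕ψ')^*`), **`…_inf_…_iff_exists_finrank_ne_transport_…`** («exceptional ⟺ imbalance»),
  **`…_iff_forall_trace_restrict_eq_zero_transport_…`** («decomposable ⟺ `θ = 0`», `θ` as printed, on `A^{n+1}`: every
  `α ∈ E₋ ⊆ End⁰(A^{n+1})` has `tr(α^* | V_ρ(fφg)) = 0` at every root `ρ` of `P_k`),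
  **`…_inf_…_iff_exists_trace_restrict_ne_zero_transport_…`** («exceptional ⟺ `θ ≠ 0`»), and
  `…_le_algebraicClasses_of_isIsogeny_biproduct_…` (balance ⟹ `W_F(Z)` algebraic, through the transport of
  algebraicity `weilClassesField_transport_le_algebraicClasses_iff`).

## Scope (honest column)

`θ` and the balance are evaluated on the POWER `A^{n+1}` through the transported field `ℚ(f ≫ φ ≫ g) = F ⊂
End⁰(A^{n+1}) = End⁰(Z)` — the print's own reduction «we may even assume that `X = Y^m`» — not through an
`E`-structure written on `End(Z)` itself; the identification `End⁰(Z) = End⁰(A^{n+1})` is van Geemen's 3.6 / Lemma 5.2,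
formalized in the transport file.  As in the parent files: «type 4» is the hypothesis on the centre of `End⁰(A)`,
`d` does not appear, positivity of the Rosati involution and the algebraic group `G_div` are not used.

## References

* [MoonenZarhin1998WeilClasses] B. J. J. Moonen, Yu. G. Zarhin, Weil classes on abelian varieties, J. reine angew.
  Math. 496 (1998) 83–92; arXiv:alg-geom/9612017: §1 (chunk p0002 L44–L51), Criterion (2) (chunk p0003 L59–L80) and
  its proof (L92–L106).
* [vanGeemen1994HodgeAV] B. van Geemen, An introduction to the Hodge conjecture for abelian varieties, LNM 1594 (1994),
  3.6, Lemma 3.7, proof of Lemma 5.2.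
* [MumfordAV1970] D. Mumford, Abelian Varieties (1970), §19 Remark p. 169, Thm. 3 p. 176, Cor. 1 p. 174.
* [Milne1999LefschetzClasses] J. S. Milne, Lefschetz classes on abelian varieties, Duke Math. J. 96 (1999), §1, Thm. 3.2,
  Cor. 4.5.
* [LangeBirkenhake1992] H. Lange, Ch. Birkenhake, Complex Abelian Varieties (1992), §1.1, §5.3.

## Provenance

Lane `lit-hodgefound` (Track 2, Layer A), prover seat `lit-hodgefound-p21` (generation 26), row g26-#3 (the «`X`
isogenous to `Y^m`» assembly of g26-#2 with the seat's isogeny transport, generation 18).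
-/

noncomputable section

open CategoryTheory CategoryTheory.Limits Polynomial Module
open Literature.AlgebraicTopology.SingularHomology
open Literature.AlgebraicGeometry.Motives
open Literature.AlgebraicGeometry.VanGeemen1994 (hodgeClassSpan pullbackOne)
open Literature.AlgebraicGeometry.Milne1999
open Literature.Barriers.HodgeConjecture (divisorClassesSpan)
open Literature.Geometry.Kaehler (lefschetzPow)

namespace Literature.AlgebraicGeometry.HodgeTheory

open CentralTorus

section IsogenousPowers

variable {A Z : AbelianVariety ℂ} {h : complexBetti A.X 2} {n k : ℕ} {ψ ψ' : A ⟶ A}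
  {f : (⨁ (fun _ : Fin (n + 1) => A)) ⟶ Z} {g : Z ⟶ ⨁ (fun _ : Fin (n + 1) => A)} {φ : Z ⟶ Z} {P R : Polynomial ℤ} {e m : ℕ}

/-- **«`W_F` DECOMPOSABLE ⟺ BALANCE», FOR `Z` ISOGENOUS TO `A^{n+1}`** (`f : A^{n+1} ⟶ Z` an isogeny with
quasi-inverse `g`, `g ≫ f = [k]`, `f ≫ g = [k]`, `k ≠ 0`): `W_F(Z) ⊗ ℂ ≤ 𝒟ᵐ(Z) ⊗ ℂ` iff, on the power `A^{n+1}` with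
the product polarization, the multiplicities of every `σ` for `(⊕ψ)^*` and `(⊕ψ')^*` agree on every eigenspace `V_ρ` of
the transported generator `(f ≫ φ ≫ g)^*` at the roots `ρ` of `P_k = P.scaleRoots k`.
[cite: MoonenZarhin1998WeilClasses, §1 («Since everything only depends on X up to isogeny, we may even assume that X = Y^m»; chunk p0002 L44–L46) and Criterion (2) («Suppose X is isogenous to a power Y^m of a simple abelian variety Y … Y is of Type 4 with d ≥ 2 or m ≥ 2 and the map θ : E₋ ↪ End_F(V_X) —Tr_F→ F is non-zero») with its proof (chunk p0003 L59–L106)]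
[cite: vanGeemen1994HodgeAV, 3.6 and proof of Lemma 5.2 («isogenies are isomorphisms on (H₁)_ℚ which preserve End_ℚ»)] [cite: MumfordAV1970, §19 Remark p. 169 (quasi-inverse of an isogeny)] -/
theorem weilClassesField_le_divisorClassesSpan_iff_forall_finrank_eq_transport_of_isIsogeny_biproduct_of_CMCentre_End
    (hA : 0 < A.dim)
    (hh : h ∈ hodgeClassSpan A.dim A.X 1) (htop : lefschetzPow h (A.dim - 1) 2 h ≠ 0)
    (hnd : ∀ x : complexBetti A.X 1, (∀ y, polarizationPairingOne A.X h (A.dim - 1) x y = 0) → x = 0)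
    (hψ : ∀ χ : A ⟶ A, ψ ≫ χ = χ ≫ ψ) (hRm : R.Monic) (hRirr : Irreducible (R.map (Int.castRingHom ℚ)))
    (hψR : Polynomial.eval₂ (Int.castRingHom (CategoryTheory.End A)) (ψ : CategoryTheory.End A) R = 0)
    (hadj : ∀ x y : complexBetti A.X 1, polarizationPairingOne A.X h (A.dim - 1) (pullbackOne A ψ x) y =
      polarizationPairingOne A.X h (A.dim - 1) x (pullbackOne A ψ' y))
    (hψ'E : ∃ N : ℤ, N ≠ 0 ∧ End.of (N • ψ') ∈ Subring.closure {End.of ψ}) (hne : ψ' ≠ ψ)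
    (hZ : ∀ g₀ : A ⟶ A, (∀ χ : A ⟶ A, g₀ ≫ χ = χ ≫ g₀) →
      ∃ N : ℤ, N ≠ 0 ∧ End.of (N • g₀) ∈ Subring.closure {End.of ψ})
    (hf : AbelianVariety.IsIsogeny f) (hgf : g ≫ f = k • 𝟙 Z) (hfg : f ≫ g = k • 𝟙 (⨁ (fun _ : Fin (n + 1) => A))) (hk : k ≠ 0)
    (hPm : P.Monic) (hPe : P.natDegree = e) (hPirr : Irreducible (P.map (Int.castRingHom ℚ)))
    (hφ : Polynomial.eval₂ (Int.castRingHom (CategoryTheory.End Z)) (End.of φ) P = 0)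
    (her : e * (2 * m) = 2 * Z.dim) (hm : m ≠ 0) :
    weilClassesField Z φ P (2 * m) ≤ divisorClassesSpan Z.X Z.dim m ↔
      ∀ ρ : ℂ, Polynomial.eval₂ (Int.castRingHom ℂ) ρ (P.scaleRoots (k : ℤ)) = 0 → ∀ σ : ℂ,
        Module.finrank ℂ ↥((pullbackOne (⨁ (fun _ : Fin (n + 1) => A)) (f ≫ φ ≫ g)).eigenspace ρ ⊓
          (pullbackOne (⨁ (fun _ : Fin (n + 1) => A)) (biproduct.map fun _ : Fin (n + 1) => ψ)).eigenspace σ) =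
        Module.finrank ℂ ↥((pullbackOne (⨁ (fun _ : Fin (n + 1) => A)) (f ≫ φ ≫ g)).eigenspace ρ ⊓
          (pullbackOne (⨁ (fun _ : Fin (n + 1) => A)) (biproduct.map fun _ : Fin (n + 1) => ψ')).eigenspace σ) := by
  have hPmX : (P.scaleRoots (k : ℤ)).Monic := (Polynomial.monic_scaleRoots_iff (k : ℤ)).2 hPm
  have hPeX : (P.scaleRoots (k : ℤ)).natDegree = e := by rw [Polynomial.natDegree_scaleRoots, hPe]
  have hPirrX := irreducible_map_scaleRoots_natCast hPirr hk
  have hφX := eval₂_transport_scaleRoots_eq_zero hgf hfg hk hφ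
  have herX : e * (2 * m) = 2 * ((n + 1) * A.dim) := by
    rw [her, ← AbelianVariety.dim_eq_of_isIsogeny hf, dim_biproduct_const_succ]
  rw [← weilClassesField_transport_le_divisorClassesSpan_iff hf hgf hk hPirr hφ m]
  exact weilClassesField_biproduct_le_divisorClassesSpan_iff_forall_finrank_eq_of_CMCentre_End hA hh htop hnd hψ hRm hRirr hψR hadj hψ'E hne hZ hPmX hPeX
    hPirrX hφX herX hm

/-- **«ALL NON-ZERO CLASSES EXCEPTIONAL ⟺ IMBALANCE», FOR `Z` ISOGENOUS TO `A^{n+1}`.**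
[cite: MoonenZarhin1998WeilClasses, §1 («Since everything only depends on X up to isogeny, we may even assume that X = Y^m»; chunk p0002 L44–L46) and Criterion (2) («Suppose X is isogenous to a power Y^m of a simple abelian variety Y … Y is of Type 4 with d ≥ 2 or m ≥ 2 and the map θ : E₋ ↪ End_F(V_X) —Tr_F→ F is non-zero») with its proof (chunk p0003 L59–L106)]
[cite: vanGeemen1994HodgeAV, 3.6 and proof of Lemma 5.2 («isogenies are isomorphisms on (H₁)_ℚ which preserve End_ℚ»)] [cite: MumfordAV1970, §19 Remark p. 169 (quasi-inverse of an isogeny)] -/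
theorem weilClassesField_inf_divisorClassesSpan_eq_bot_iff_exists_finrank_ne_transport_of_isIsogeny_biproduct_of_CMCentre_End
    (hA : 0 < A.dim)
    (hh : h ∈ hodgeClassSpan A.dim A.X 1) (htop : lefschetzPow h (A.dim - 1) 2 h ≠ 0)
    (hnd : ∀ x : complexBetti A.X 1, (∀ y, polarizationPairingOne A.X h (A.dim - 1) x y = 0) → x = 0)
    (hψ : ∀ χ : A ⟶ A, ψ ≫ χ = χ ≫ ψ) (hRm : R.Monic) (hRirr : Irreducible (R.map (Int.castRingHom ℚ)))
    (hψR : Polynomial.eval₂ (Int.castRingHom (CategoryTheory.End A)) (ψ : CategoryTheory.End A) R = 0)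
    (hadj : ∀ x y : complexBetti A.X 1, polarizationPairingOne A.X h (A.dim - 1) (pullbackOne A ψ x) y =
      polarizationPairingOne A.X h (A.dim - 1) x (pullbackOne A ψ' y))
    (hψ'E : ∃ N : ℤ, N ≠ 0 ∧ End.of (N • ψ') ∈ Subring.closure {End.of ψ}) (hne : ψ' ≠ ψ)
    (hZ : ∀ g₀ : A ⟶ A, (∀ χ : A ⟶ A, g₀ ≫ χ = χ ≫ g₀) →
      ∃ N : ℤ, N ≠ 0 ∧ End.of (N • g₀) ∈ Subring.closure {End.of ψ})
    (hf : AbelianVariety.IsIsogeny f) (hgf : g ≫ f = k • 𝟙 Z) (hfg : f ≫ g = k • 𝟙 (⨁ (fun _ : Fin (n + 1) => A))) (hk : k ≠ 0)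
    (hPm : P.Monic) (hPe : P.natDegree = e) (hPirr : Irreducible (P.map (Int.castRingHom ℚ)))
    (hφ : Polynomial.eval₂ (Int.castRingHom (CategoryTheory.End Z)) (End.of φ) P = 0)
    (her : e * (2 * m) = 2 * Z.dim) (hm : m ≠ 0) :
    weilClassesField Z φ P (2 * m) ⊓ divisorClassesSpan Z.X Z.dim m = ⊥ ↔
      ∃ ρ σ : ℂ, Polynomial.eval₂ (Int.castRingHom ℂ) ρ (P.scaleRoots (k : ℤ)) = 0 ∧
        Module.finrank ℂ ↥((pullbackOne (⨁ (fun _ : Fin (n + 1) => A)) (f ≫ φ ≫ g)).eigenspace ρ ⊓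
          (pullbackOne (⨁ (fun _ : Fin (n + 1) => A)) (biproduct.map fun _ : Fin (n + 1) => ψ)).eigenspace σ) ≠
        Module.finrank ℂ ↥((pullbackOne (⨁ (fun _ : Fin (n + 1) => A)) (f ≫ φ ≫ g)).eigenspace ρ ⊓
          (pullbackOne (⨁ (fun _ : Fin (n + 1) => A)) (biproduct.map fun _ : Fin (n + 1) => ψ')).eigenspace σ) := by
  have hPmX : (P.scaleRoots (k : ℤ)).Monic := (Polynomial.monic_scaleRoots_iff (k : ℤ)).2 hPm
  have hPeX : (P.scaleRoots (k : ℤ)).natDegree = e := by rw [Polynomial.natDegree_scaleRoots, hPe]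
  have hPirrX := irreducible_map_scaleRoots_natCast hPirr hk
  have hφX := eval₂_transport_scaleRoots_eq_zero hgf hfg hk hφ
  have herX : e * (2 * m) = 2 * ((n + 1) * A.dim) := by
    rw [her, ← AbelianVariety.dim_eq_of_isIsogeny hf, dim_biproduct_const_succ]
  rw [← weilClassesField_transport_inf_divisorClassesSpan_eq_bot_iff hf hgf hk hPirr hφ m]
  exact weilClassesField_biproduct_inf_divisorClassesSpan_eq_bot_iff_exists_finrank_ne_of_CMCentre_End hA hh htop hnd hψ hRm hRirr hψR hadj hψ'E hne hZ hPmX hPeX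
    hPirrX hφX herX hm

/-- **THE DICHOTOMY AS PRINTED — «Suppose `X` is isogenous to a power `Y^m` … Then either all classes in `W_F` are
decomposable, or all non-zero classes in `W_F` are exceptional»**, for `X = Z` isogenous to `A^{n+1}` through an
explicit isogeny `f : A^{n+1} ⟶ Z`, `A` with CM centre (every `d`), every `F = ℚ(φ) ⊆ End⁰(Z)`.
[cite: MoonenZarhin1998WeilClasses, §1 Criterion (2), first assertion (chunk p0003 L59–L67), type 4] -/
theorem weilClassesField_le_or_inf_divisorClassesSpan_eq_bot_of_isIsogeny_biproduct_of_CMCentre_End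
    (hA : 0 < A.dim)
    (hh : h ∈ hodgeClassSpan A.dim A.X 1) (htop : lefschetzPow h (A.dim - 1) 2 h ≠ 0)
    (hnd : ∀ x : complexBetti A.X 1, (∀ y, polarizationPairingOne A.X h (A.dim - 1) x y = 0) → x = 0)
    (hψ : ∀ χ : A ⟶ A, ψ ≫ χ = χ ≫ ψ) (hRm : R.Monic) (hRirr : Irreducible (R.map (Int.castRingHom ℚ)))
    (hψR : Polynomial.eval₂ (Int.castRingHom (CategoryTheory.End A)) (ψ : CategoryTheory.End A) R = 0)
    (hadj : ∀ x y : complexBetti A.X 1, polarizationPairingOne A.X h (A.dim - 1) (pullbackOne A ψ x) y =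
      polarizationPairingOne A.X h (A.dim - 1) x (pullbackOne A ψ' y))
    (hψ'E : ∃ N : ℤ, N ≠ 0 ∧ End.of (N • ψ') ∈ Subring.closure {End.of ψ}) (hne : ψ' ≠ ψ)
    (hZ : ∀ g₀ : A ⟶ A, (∀ χ : A ⟶ A, g₀ ≫ χ = χ ≫ g₀) →
      ∃ N : ℤ, N ≠ 0 ∧ End.of (N • g₀) ∈ Subring.closure {End.of ψ})
    (hf : AbelianVariety.IsIsogeny f) (hgf : g ≫ f = k • 𝟙 Z) (hfg : f ≫ g = k • 𝟙 (⨁ (fun _ : Fin (n + 1) => A))) (hk : k ≠ 0)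
    (hPm : P.Monic) (hPe : P.natDegree = e) (hPirr : Irreducible (P.map (Int.castRingHom ℚ)))
    (hφ : Polynomial.eval₂ (Int.castRingHom (CategoryTheory.End Z)) (End.of φ) P = 0)
    (her : e * (2 * m) = 2 * Z.dim) (hm : m ≠ 0) :
    weilClassesField Z φ P (2 * m) ≤ divisorClassesSpan Z.X Z.dim m ∨
      weilClassesField Z φ P (2 * m) ⊓ divisorClassesSpan Z.X Z.dim m = ⊥ := by
  have hPmX : (P.scaleRoots (k : ℤ)).Monic := (Polynomial.monic_scaleRoots_iff (k : ℤ)).2 hPm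
  have hPeX : (P.scaleRoots (k : ℤ)).natDegree = e := by rw [Polynomial.natDegree_scaleRoots, hPe]
  have hPirrX := irreducible_map_scaleRoots_natCast hPirr hk
  have hφX := eval₂_transport_scaleRoots_eq_zero hgf hfg hk hφ
  have herX : e * (2 * m) = 2 * ((n + 1) * A.dim) := by
    rw [her, ← AbelianVariety.dim_eq_of_isIsogeny hf, dim_biproduct_const_succ]
  rcases weilClassesField_biproduct_le_or_inf_divisorClassesSpan_eq_bot_of_CMCentre_End (φ := f ≫ φ ≫ g) hA hh htop hnd hψ hRm hRirr hψR hadj hψ'E hne hZ hPmX hPeX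
    hPirrX hφX herX hm with hle | hbot
  · exact Or.inl ((weilClassesField_transport_le_divisorClassesSpan_iff hf hgf hk hPirr hφ m).1 hle)
  · exact Or.inr ((weilClassesField_transport_inf_divisorClassesSpan_eq_bot_iff hf hgf hk hPirr hφ m).1 hbot)

/-- **«`W_F` DECOMPOSABLE ⟺ `θ : E₋ ↪ End_F(V_X) —Tr_F→ F` IS ZERO», FOR `Z` ISOGENOUS TO `A^{n+1}`**, `θ` as printed
and read on the power: `W_F(Z) ⊗ ℂ ≤ 𝒟ᵐ(Z) ⊗ ℂ` iff every `α ∈ End(A^{n+1})` in `E = ℚ(⊕ψ)` (`N α ∈ ℤ[⊕ψ]`) that is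
Rosati-skew for the product polarization has `tr(α^* | V_ρ) = 0` on every eigenspace `V_ρ` of `(f ≫ φ ≫ g)^*` at the
roots of `P_k`.
[cite: MoonenZarhin1998WeilClasses, §1 («Since everything only depends on X up to isogeny, we may even assume that X = Y^m»; chunk p0002 L44–L46) and Criterion (2) («Suppose X is isogenous to a power Y^m of a simple abelian variety Y … Y is of Type 4 with d ≥ 2 or m ≥ 2 and the map θ : E₋ ↪ End_F(V_X) —Tr_F→ F is non-zero») with its proof (chunk p0003 L59–L106)]
[cite: vanGeemen1994HodgeAV, 3.6 and proof of Lemma 5.2 («isogenies are isomorphisms on (H₁)_ℚ which preserve End_ℚ»)] [cite: MumfordAV1970, §19 Remark p. 169 (quasi-inverse of an isogeny)] -/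
theorem weilClassesField_le_divisorClassesSpan_iff_forall_trace_restrict_eq_zero_transport_of_isIsogeny_biproduct_of_CMCentre_End
    (hA : 0 < A.dim)
    (hh : h ∈ hodgeClassSpan A.dim A.X 1) (htop : lefschetzPow h (A.dim - 1) 2 h ≠ 0)
    (hnd : ∀ x : complexBetti A.X 1, (∀ y, polarizationPairingOne A.X h (A.dim - 1) x y = 0) → x = 0)
    (hψ : ∀ χ : A ⟶ A, ψ ≫ χ = χ ≫ ψ) (hRm : R.Monic) (hRirr : Irreducible (R.map (Int.castRingHom ℚ)))
    (hψR : Polynomial.eval₂ (Int.castRingHom (CategoryTheory.End A)) (ψ : CategoryTheory.End A) R = 0)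
    (hadj : ∀ x y : complexBetti A.X 1, polarizationPairingOne A.X h (A.dim - 1) (pullbackOne A ψ x) y =
      polarizationPairingOne A.X h (A.dim - 1) x (pullbackOne A ψ' y))
    (hψ'E : ∃ N : ℤ, N ≠ 0 ∧ End.of (N • ψ') ∈ Subring.closure {End.of ψ}) (hne : ψ' ≠ ψ)
    (hZ : ∀ g₀ : A ⟶ A, (∀ χ : A ⟶ A, g₀ ≫ χ = χ ≫ g₀) →
      ∃ N : ℤ, N ≠ 0 ∧ End.of (N • g₀) ∈ Subring.closure {End.of ψ})
    (hf : AbelianVariety.IsIsogeny f) (hgf : g ≫ f = k • 𝟙 Z) (hfg : f ≫ g = k • 𝟙 (⨁ (fun _ : Fin (n + 1) => A))) (hk : k ≠ 0)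
    (hPm : P.Monic) (hPe : P.natDegree = e) (hPirr : Irreducible (P.map (Int.castRingHom ℚ)))
    (hφ : Polynomial.eval₂ (Int.castRingHom (CategoryTheory.End Z)) (End.of φ) P = 0)
    (her : e * (2 * m) = 2 * Z.dim) (hm : m ≠ 0) :
    weilClassesField Z φ P (2 * m) ≤ divisorClassesSpan Z.X Z.dim m ↔
      ∀ (α : ⨁ (fun _ : Fin (n + 1) => A) ⟶ ⨁ (fun _ : Fin (n + 1) => A))
        (hα : ∃ N : ℤ, N ≠ 0 ∧ End.of (N • α) ∈ Subring.closure {End.of (biproduct.map fun _ : Fin (n + 1) => ψ)}),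
        (∀ u v, polarizationPairingOne (⨁ (fun _ : Fin (n + 1) => A)).X (sumPolarizationClass (fun _ : Fin (n + 1) => A) fun _ => h) ((⨁ (fun _ : Fin (n + 1) => A)).dim - 1) (pullbackOne (⨁ (fun _ : Fin (n + 1) => A)) α u) v =
          -polarizationPairingOne (⨁ (fun _ : Fin (n + 1) => A)).X (sumPolarizationClass (fun _ : Fin (n + 1) => A) fun _ => h) ((⨁ (fun _ : Fin (n + 1) => A)).dim - 1) u (pullbackOne (⨁ (fun _ : Fin (n + 1) => A)) α v)) →
        ∀ ρ : ℂ, Polynomial.eval₂ (Int.castRingHom ℂ) ρ (P.scaleRoots (k : ℤ)) = 0 →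
          LinearMap.trace ℂ _ ((pullbackOne (⨁ (fun _ : Fin (n + 1) => A)) α).restrict
            (mapsTo_eigenspace_pullbackOne_of_exists_zsmul_mem_closure (biproductMap_const_comm_of_forall_comm hψ)
              hα (f ≫ φ ≫ g) ρ)) = 0 := by
  have hPmX : (P.scaleRoots (k : ℤ)).Monic := (Polynomial.monic_scaleRoots_iff (k : ℤ)).2 hPm
  have hPeX : (P.scaleRoots (k : ℤ)).natDegree = e := by rw [Polynomial.natDegree_scaleRoots, hPe]
  have hPirrX := irreducible_map_scaleRoots_natCast hPirr hk
  have hφX := eval₂_transport_scaleRoots_eq_zero hgf hfg hk hφ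
  have herX : e * (2 * m) = 2 * ((n + 1) * A.dim) := by
    rw [her, ← AbelianVariety.dim_eq_of_isIsogeny hf, dim_biproduct_const_succ]
  rw [← weilClassesField_transport_le_divisorClassesSpan_iff hf hgf hk hPirr hφ m]
  exact weilClassesField_biproduct_le_divisorClassesSpan_iff_forall_trace_restrict_eq_zero_of_CMCentre_End hA hh htop hnd hψ hRm hRirr hψR hadj hψ'E hne hZ hPmX hPeX
    hPirrX hφX herX hm

/-- **«ALL NON-ZERO CLASSES EXCEPTIONAL ⟺ `θ ≠ 0`», FOR `Z` ISOGENOUS TO `A^{n+1}`.**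
[cite: MoonenZarhin1998WeilClasses, §1 («Since everything only depends on X up to isogeny, we may even assume that X = Y^m»; chunk p0002 L44–L46) and Criterion (2) («Suppose X is isogenous to a power Y^m of a simple abelian variety Y … Y is of Type 4 with d ≥ 2 or m ≥ 2 and the map θ : E₋ ↪ End_F(V_X) —Tr_F→ F is non-zero») with its proof (chunk p0003 L59–L106)]
[cite: vanGeemen1994HodgeAV, 3.6 and proof of Lemma 5.2 («isogenies are isomorphisms on (H₁)_ℚ which preserve End_ℚ»)] [cite: MumfordAV1970, §19 Remark p. 169 (quasi-inverse of an isogeny)] -/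
theorem weilClassesField_inf_divisorClassesSpan_eq_bot_iff_exists_trace_restrict_ne_zero_transport_of_isIsogeny_biproduct_of_CMCentre_End
    (hA : 0 < A.dim)
    (hh : h ∈ hodgeClassSpan A.dim A.X 1) (htop : lefschetzPow h (A.dim - 1) 2 h ≠ 0)
    (hnd : ∀ x : complexBetti A.X 1, (∀ y, polarizationPairingOne A.X h (A.dim - 1) x y = 0) → x = 0)
    (hψ : ∀ χ : A ⟶ A, ψ ≫ χ = χ ≫ ψ) (hRm : R.Monic) (hRirr : Irreducible (R.map (Int.castRingHom ℚ)))
    (hψR : Polynomial.eval₂ (Int.castRingHom (CategoryTheory.End A)) (ψ : CategoryTheory.End A) R = 0)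
    (hadj : ∀ x y : complexBetti A.X 1, polarizationPairingOne A.X h (A.dim - 1) (pullbackOne A ψ x) y =
      polarizationPairingOne A.X h (A.dim - 1) x (pullbackOne A ψ' y))
    (hψ'E : ∃ N : ℤ, N ≠ 0 ∧ End.of (N • ψ') ∈ Subring.closure {End.of ψ}) (hne : ψ' ≠ ψ)
    (hZ : ∀ g₀ : A ⟶ A, (∀ χ : A ⟶ A, g₀ ≫ χ = χ ≫ g₀) →
      ∃ N : ℤ, N ≠ 0 ∧ End.of (N • g₀) ∈ Subring.closure {End.of ψ})
    (hf : AbelianVariety.IsIsogeny f) (hgf : g ≫ f = k • 𝟙 Z) (hfg : f ≫ g = k • 𝟙 (⨁ (fun _ : Fin (n + 1) => A))) (hk : k ≠ 0)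
    (hPm : P.Monic) (hPe : P.natDegree = e) (hPirr : Irreducible (P.map (Int.castRingHom ℚ)))
    (hφ : Polynomial.eval₂ (Int.castRingHom (CategoryTheory.End Z)) (End.of φ) P = 0)
    (her : e * (2 * m) = 2 * Z.dim) (hm : m ≠ 0) :
    weilClassesField Z φ P (2 * m) ⊓ divisorClassesSpan Z.X Z.dim m = ⊥ ↔
      ∃ (α : ⨁ (fun _ : Fin (n + 1) => A) ⟶ ⨁ (fun _ : Fin (n + 1) => A))
        (hα : ∃ N : ℤ, N ≠ 0 ∧ End.of (N • α) ∈ Subring.closure {End.of (biproduct.map fun _ : Fin (n + 1) => ψ)}),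
        (∀ u v, polarizationPairingOne (⨁ (fun _ : Fin (n + 1) => A)).X (sumPolarizationClass (fun _ : Fin (n + 1) => A) fun _ => h) ((⨁ (fun _ : Fin (n + 1) => A)).dim - 1) (pullbackOne (⨁ (fun _ : Fin (n + 1) => A)) α u) v =
          -polarizationPairingOne (⨁ (fun _ : Fin (n + 1) => A)).X (sumPolarizationClass (fun _ : Fin (n + 1) => A) fun _ => h) ((⨁ (fun _ : Fin (n + 1) => A)).dim - 1) u (pullbackOne (⨁ (fun _ : Fin (n + 1) => A)) α v)) ∧
        ∃ ρ : ℂ, Polynomial.eval₂ (Int.castRingHom ℂ) ρ (P.scaleRoots (k : ℤ)) = 0 ∧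
          LinearMap.trace ℂ _ ((pullbackOne (⨁ (fun _ : Fin (n + 1) => A)) α).restrict
            (mapsTo_eigenspace_pullbackOne_of_exists_zsmul_mem_closure (biproductMap_const_comm_of_forall_comm hψ)
              hα (f ≫ φ ≫ g) ρ)) ≠ 0 := by
  have hPmX : (P.scaleRoots (k : ℤ)).Monic := (Polynomial.monic_scaleRoots_iff (k : ℤ)).2 hPm
  have hPeX : (P.scaleRoots (k : ℤ)).natDegree = e := by rw [Polynomial.natDegree_scaleRoots, hPe]
  have hPirrX := irreducible_map_scaleRoots_natCast hPirr hk
  have hφX := eval₂_transport_scaleRoots_eq_zero hgf hfg hk hφ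
  have herX : e * (2 * m) = 2 * ((n + 1) * A.dim) := by
    rw [her, ← AbelianVariety.dim_eq_of_isIsogeny hf, dim_biproduct_const_succ]
  rw [← weilClassesField_transport_inf_divisorClassesSpan_eq_bot_iff hf hgf hk hPirr hφ m]
  exact weilClassesField_biproduct_inf_divisorClassesSpan_eq_bot_iff_exists_trace_restrict_ne_zero_of_CMCentre_End hA hh htop hnd hψ hRm hRirr hψR hadj hψ'E hne hZ hPmX hPeX
    hPirrX hφX herX hm

/-- **BALANCE ⟹ `W_F(Z)` ALGEBRAIC**, for `Z` isogenous to `A^{n+1}` (algebraicity transports along isogenies —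
van Geemen's Lemma 3.7 — and on the power it follows from Lefschetz (1,1) and products).
[cite: MoonenZarhin1998WeilClasses, Introduction (chunk p0001 L10–L18) and §1 Criterion (2) (chunk p0003 L59–L80)]
[cite: vanGeemen1994HodgeAV, 3.6 and Lemma 3.7] [cite: VoisinHodgeI2002, Thm. 11.30] -/
theorem weilClassesField_le_algebraicClasses_of_isIsogeny_biproduct_of_CMCentre_End_of_forall_finrank_eq
    (hA : 0 < A.dim)
    (hh : h ∈ hodgeClassSpan A.dim A.X 1) (htop : lefschetzPow h (A.dim - 1) 2 h ≠ 0)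
    (hnd : ∀ x : complexBetti A.X 1, (∀ y, polarizationPairingOne A.X h (A.dim - 1) x y = 0) → x = 0)
    (hψ : ∀ χ : A ⟶ A, ψ ≫ χ = χ ≫ ψ) (hRm : R.Monic) (hRirr : Irreducible (R.map (Int.castRingHom ℚ)))
    (hψR : Polynomial.eval₂ (Int.castRingHom (CategoryTheory.End A)) (ψ : CategoryTheory.End A) R = 0)
    (hadj : ∀ x y : complexBetti A.X 1, polarizationPairingOne A.X h (A.dim - 1) (pullbackOne A ψ x) y =
      polarizationPairingOne A.X h (A.dim - 1) x (pullbackOne A ψ' y))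
    (hψ'E : ∃ N : ℤ, N ≠ 0 ∧ End.of (N • ψ') ∈ Subring.closure {End.of ψ}) (hne : ψ' ≠ ψ)
    (hZ : ∀ g₀ : A ⟶ A, (∀ χ : A ⟶ A, g₀ ≫ χ = χ ≫ g₀) →
      ∃ N : ℤ, N ≠ 0 ∧ End.of (N • g₀) ∈ Subring.closure {End.of ψ})
    (hf : AbelianVariety.IsIsogeny f) (hgf : g ≫ f = k • 𝟙 Z) (hfg : f ≫ g = k • 𝟙 (⨁ (fun _ : Fin (n + 1) => A))) (hk : k ≠ 0)
    (hPm : P.Monic) (hPe : P.natDegree = e) (hPirr : Irreducible (P.map (Int.castRingHom ℚ)))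
    (hφ : Polynomial.eval₂ (Int.castRingHom (CategoryTheory.End Z)) (End.of φ) P = 0)
    (her : e * (2 * m) = 2 * Z.dim) (hm : m ≠ 0)
    (hbal : ∀ ρ : ℂ, Polynomial.eval₂ (Int.castRingHom ℂ) ρ (P.scaleRoots (k : ℤ)) = 0 → ∀ σ : ℂ,
        Module.finrank ℂ ↥((pullbackOne (⨁ (fun _ : Fin (n + 1) => A)) (f ≫ φ ≫ g)).eigenspace ρ ⊓
          (pullbackOne (⨁ (fun _ : Fin (n + 1) => A)) (biproduct.map fun _ : Fin (n + 1) => ψ)).eigenspace σ) =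
        Module.finrank ℂ ↥((pullbackOne (⨁ (fun _ : Fin (n + 1) => A)) (f ≫ φ ≫ g)).eigenspace ρ ⊓
          (pullbackOne (⨁ (fun _ : Fin (n + 1) => A)) (biproduct.map fun _ : Fin (n + 1) => ψ')).eigenspace σ)) :
    weilClassesField Z φ P (2 * m) ≤ algebraicClasses Z.X m := by
  have hPmX : (P.scaleRoots (k : ℤ)).Monic := (Polynomial.monic_scaleRoots_iff (k : ℤ)).2 hPm
  have hPeX : (P.scaleRoots (k : ℤ)).natDegree = e := by rw [Polynomial.natDegree_scaleRoots, hPe]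
  have hPirrX := irreducible_map_scaleRoots_natCast hPirr hk
  have hφX := eval₂_transport_scaleRoots_eq_zero hgf hfg hk hφ
  have herX : e * (2 * m) = 2 * ((n + 1) * A.dim) := by
    rw [her, ← AbelianVariety.dim_eq_of_isIsogeny hf, dim_biproduct_const_succ]
  rw [← weilClassesField_transport_le_algebraicClasses_iff hf hgf hk hPirr hφ m]
  exact weilClassesField_biproduct_le_algebraicClasses_of_CMCentre_End_of_forall_finrank_eq hA hh htop hnd hψ hRm hRirr hψR hadj hψ'E hne hZ hPmX hPeX
    hPirrX hφX herX hm hbal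

/-- **THE DICHOTOMY FOR EVERY `Z` WITH `A^{n+1}` ISOGENOUS TO `Z`** (`AbelianVariety.IsIsogenous (⨁ A) Z`; the
quasi-inverse from the tree's `IsIsogeny.exists_nsmul_inverse_holds`, Mumford §19).
[cite: MoonenZarhin1998WeilClasses, §1 Criterion (2), first assertion (chunk p0003 L59–L67), type 4] [cite: MumfordAV1970, §19 Remark p. 169] -/
theorem weilClassesField_le_or_inf_divisorClassesSpan_eq_bot_of_isIsogenous_biproduct_of_CMCentre_End
    (hA : 0 < A.dim)
    (hh : h ∈ hodgeClassSpan A.dim A.X 1) (htop : lefschetzPow h (A.dim - 1) 2 h ≠ 0)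
    (hnd : ∀ x : complexBetti A.X 1, (∀ y, polarizationPairingOne A.X h (A.dim - 1) x y = 0) → x = 0)
    (hψ : ∀ χ : A ⟶ A, ψ ≫ χ = χ ≫ ψ) (hRm : R.Monic) (hRirr : Irreducible (R.map (Int.castRingHom ℚ)))
    (hψR : Polynomial.eval₂ (Int.castRingHom (CategoryTheory.End A)) (ψ : CategoryTheory.End A) R = 0)
    (hadj : ∀ x y : complexBetti A.X 1, polarizationPairingOne A.X h (A.dim - 1) (pullbackOne A ψ x) y =
      polarizationPairingOne A.X h (A.dim - 1) x (pullbackOne A ψ' y))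
    (hψ'E : ∃ N : ℤ, N ≠ 0 ∧ End.of (N • ψ') ∈ Subring.closure {End.of ψ}) (hne : ψ' ≠ ψ)
    (hZ : ∀ g₀ : A ⟶ A, (∀ χ : A ⟶ A, g₀ ≫ χ = χ ≫ g₀) →
      ∃ N : ℤ, N ≠ 0 ∧ End.of (N • g₀) ∈ Subring.closure {End.of ψ})
    (hXZ : AbelianVariety.IsIsogenous (⨁ (fun _ : Fin (n + 1) => A)) Z)
    (hPm : P.Monic) (hPe : P.natDegree = e) (hPirr : Irreducible (P.map (Int.castRingHom ℚ)))
    (hφ : Polynomial.eval₂ (Int.castRingHom (CategoryTheory.End Z)) (End.of φ) P = 0)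
    (her : e * (2 * m) = 2 * Z.dim) (hm : m ≠ 0) :
    weilClassesField Z φ P (2 * m) ≤ divisorClassesSpan Z.X Z.dim m ∨
      weilClassesField Z φ P (2 * m) ⊓ divisorClassesSpan Z.X Z.dim m = ⊥ := by
  obtain ⟨f, hf⟩ := hXZ
  obtain ⟨g, k, hk, hfg, hgf⟩ := AbelianVariety.IsIsogeny.exists_nsmul_inverse_holds hf
  exact weilClassesField_le_or_inf_divisorClassesSpan_eq_bot_of_isIsogeny_biproduct_of_CMCentre_End hA hh htop hnd hψ hRm
    hRirr hψR hadj hψ'E hne hZ hf hgf hfg hk.ne' hPm hPe hPirr hφ her hm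

/-- **… and for every `Z` with `Z` isogenous to `A^{n+1}`** (`AbelianVariety.IsIsogenous Z (⨁ A)`; isogeny is
symmetric, the tree's `IsIsogenous.symm'`). [cite: MoonenZarhin1998WeilClasses, §1 Criterion (2), first assertion (chunk p0003 L59–L67), type 4]
[cite: MumfordAV1970, §19 Remark p. 169] -/
theorem weilClassesField_le_or_inf_divisorClassesSpan_eq_bot_of_isIsogenous_biproduct'_of_CMCentre_End
    (hA : 0 < A.dim)
    (hh : h ∈ hodgeClassSpan A.dim A.X 1) (htop : lefschetzPow h (A.dim - 1) 2 h ≠ 0)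
    (hnd : ∀ x : complexBetti A.X 1, (∀ y, polarizationPairingOne A.X h (A.dim - 1) x y = 0) → x = 0)
    (hψ : ∀ χ : A ⟶ A, ψ ≫ χ = χ ≫ ψ) (hRm : R.Monic) (hRirr : Irreducible (R.map (Int.castRingHom ℚ)))
    (hψR : Polynomial.eval₂ (Int.castRingHom (CategoryTheory.End A)) (ψ : CategoryTheory.End A) R = 0)
    (hadj : ∀ x y : complexBetti A.X 1, polarizationPairingOne A.X h (A.dim - 1) (pullbackOne A ψ x) y =
      polarizationPairingOne A.X h (A.dim - 1) x (pullbackOne A ψ' y))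
    (hψ'E : ∃ N : ℤ, N ≠ 0 ∧ End.of (N • ψ') ∈ Subring.closure {End.of ψ}) (hne : ψ' ≠ ψ)
    (hZ : ∀ g₀ : A ⟶ A, (∀ χ : A ⟶ A, g₀ ≫ χ = χ ≫ g₀) →
      ∃ N : ℤ, N ≠ 0 ∧ End.of (N • g₀) ∈ Subring.closure {End.of ψ})
    (hZX : AbelianVariety.IsIsogenous Z (⨁ (fun _ : Fin (n + 1) => A)))
    (hPm : P.Monic) (hPe : P.natDegree = e) (hPirr : Irreducible (P.map (Int.castRingHom ℚ)))
    (hφ : Polynomial.eval₂ (Int.castRingHom (CategoryTheory.End Z)) (End.of φ) P = 0)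
    (her : e * (2 * m) = 2 * Z.dim) (hm : m ≠ 0) :
    weilClassesField Z φ P (2 * m) ≤ divisorClassesSpan Z.X Z.dim m ∨
      weilClassesField Z φ P (2 * m) ⊓ divisorClassesSpan Z.X Z.dim m = ⊥ :=
  weilClassesField_le_or_inf_divisorClassesSpan_eq_bot_of_isIsogenous_biproduct_of_CMCentre_End hA hh htop hnd hψ hRm hRirr
    hψR hadj hψ'E hne hZ hZX.symm' hPm hPe hPirr hφ her hm

end IsogenousPowers

end Literature.AlgebraicGeometry.HodgeTheory

end
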